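import Literature.ModelTheory.FiniteModelTheory.CohomologicalConsistency
import Literature.ModelTheory.FiniteModelTheory.GraphSectionLists
import Literature.LinearAlgebra.Matrix.IntegerLinearSolvability
import Mathlib.Algebra.BigOperators.Finsupp.Basic
import HarnessLib

/-!
# The cohomological `k`-consistency algorithm for graphs as a list program, and its correctness

Topic `Literature/ModelTheory/FiniteModelTheory`.  Ó Conghaile's cohomological `k`-consistency
algorithm (Ó Conghaile 2022, §4.3.1, Definition 5: iterate the operator `(·)^{ℤ↓}` removing the
local sections that fail `Forth` or `ℤext` from `𝓗_k(G,H)` until it stabilises, accept iff something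
is left; `ℤext` is solvability over `ℤ` of a linear system, §4.2) for GRAPHS `G` on `Fin n`, `H` on
`Fin q`, written as a total functional program on the list format of `GraphSectionLists.lean` and
proved to decide `GraphCohomologicallyKConsistent k G H` (`CohomologicalConsistency.lean`):

* `homSecs` — the list of `𝓗_k(G,H)` (`sys_homSecs`); `forthL` — the forth test (`forthL_iff`);
* `eqRows` — the linear system of `ℤext(𝓢, s)`: unknowns = the members of the current list `S`,
  equations `x_s = 1`, `x_t = 0` for the other `t` over the context of `s`, and for contexts
  `D ⊆ U` (`|U| ≤ k`) and every colouring `u` of `D` the compatibility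
  `Σ_{t ∈ S(U), t|_D = u} x_t = [u ∈ S] x_u`; `zextL` decides it with `IntSolve.intSolvable`
  (`IntegerLinearSolvability.lean`) and **`zextL_iff : zextL … S t = true ↔ ZExt k (sys S) C s`**;
* `reduceL`, `iterL`, `decideL` and **`decideL_eq_true_iff`**:
  `decideL D k q adjH n adjG = true ↔ GraphCohomologicallyKConsistent k G H` (for a determinant
  routine `D` and adjacency tests `adjG`, `adjH` of `G`, `H`).

The system `sys S` of a list `S` is `U ↦ {s | listOfP (pOf U s) ∈ S}`.  Everything is proved; the
machine side (the program runs in time polynomial in `n` for fixed `k`, `q`) is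
`CohomologicalConsistencyComplexityProofs.lean`.

## References

* A. Ó Conghaile, *Cohomology in Constraint Satisfaction and Structure Isomorphism*, MFCS 2022,
  LIPIcs 241, 75:1–75:16 = arXiv:2206.15253 [OConghaile2022]: §4.2 (`ℤext` as a linear system over
  `ℤ`), §4.3.1 Def. 5 (the algorithm), Appendix (proof of Prop. "efficient").
-/

namespace Literature.ModelTheory.FiniteModelTheory

namespace GCKCDecide

open Finset SecLists Literature.LinearAlgebra.Matrix Literature.LinearAlgebra.Matrix.RowSelect
  Literature.LinearAlgebra.Matrix.IntSolve Literature.LinearAlgebra.Matrix.Berkowitz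

/-! ### The program -/

section Program

variable (D : List (List ℤ) → ℤ)

/-- The hom condition on a pair of (position, colour) entries. [cite: OConghaile2022, §3.1] -/
def pairOK (adjH adjG : ℕ → ℕ → Bool) (p p' : ℕ × Option ℕ) : Bool :=
  match p.2, p'.2 with
  | some c, some d => !(adjG p.1 p'.1) || adjH c d
  | _, _ => true

/-- Indexed entries of a list. [folklore] -/
def enum (t : OSec) : List (ℕ × Option ℕ) := (List.range t.length).zip t

/-- The test "partial homomorphism": adjacent coloured vertices get adjacent colours.
[cite: OConghaile2022, §3.1] -/
def isHom (adjH adjG : ℕ → ℕ → Bool) (t : OSec) : Bool := (enum t).all fun p => (enum t).all fun p' => pairOK adjH adjG p p'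

/-- THE LIST OF `𝓗_k(G,H)`: partial homomorphisms on `≤ k` vertices. [cite: OConghaile2022, §3.1] -/
def homSecs (k q : ℕ) (adjH : ℕ → ℕ → Bool) (n : ℕ) (adjG : ℕ → ℕ → Bool) : List OSec :=
  (upTo q n k).filter (isHom adjH adjG)

/-- `t'` extends `t` to the vertex `a` (and agrees with `t` elsewhere, and at `a` if `t` colours
`a`). [cite: OConghaile2022, §2.2] -/
def forthOK (t t' : OSec) (a : ℕ) : Bool :=
  (t'.getD a none).isSome && (t'.set a none == t.set a none) && (!(t.getD a none).isSome || t' == t)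

/-- THE FORTH TEST `Forth(𝓢, s)`. [cite: OConghaile2022, §2.2 and §3.3.1] -/
def forthL (k n : ℕ) (S : List OSec) (t : OSec) : Bool :=
  !decide ((domL t).length < k) || (List.range n).all fun a => S.any fun t' => forthOK t t' a

/-- Indicator as an integer. [folklore] -/
def ind (b : Bool) : ℤ := if b then 1 else 0

/-- The equations `x_t = [t = t₀]` for the members `t` over the context of `t₀`.
[cite: OConghaile2022, §4.2] -/
def pinRows (S : List OSec) (t₀ : OSec) : List (List ℤ × ℤ) :=
  (S.filter fun t => domL t == domL t₀).map fun t => (S.map fun t' => ind (t' == t), ind (t == t₀))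

/-- The compatibility equation for the contexts `Dl ⊆ Ul` and the colouring `ul` of `Dl`:
`Σ_{t ∈ S(U), t|_D = u} x_t − [u ∈ S] x_u = 0`. [cite: OConghaile2022, §4.2] -/
def compatRow (S : List OSec) (Ul Dl : List ℕ) (ul : OSec) : List ℤ × ℤ :=
  (S.map fun t => ind (domL t == Ul && restrL t Dl == ul) - ind (t == ul), 0)

/-- All compatibility equations for contexts of size `≤ k`. [cite: OConghaile2022, §4.2] -/
def compatRows (k q n : ℕ) (S : List OSec) : List (List ℤ × ℤ) :=
  (domsUpTo n k).flatMap fun Ul => (subl k Ul).flatMap fun Dl => (colourings q n k Dl).map fun ul => compatRow S Ul Dl ul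

/-- THE LINEAR SYSTEM of `ℤext(𝓢, s)` (rows = (coefficients over `S`, right hand side)).
[cite: OConghaile2022, §4.2] -/
def eqRows (k q n : ℕ) (S : List OSec) (t₀ : OSec) : List (List ℤ × ℤ) := pinRows S t₀ ++ compatRows k q n S

/-- THE `ℤext` TEST: solvability of the system over `ℤ`. [cite: OConghaile2022, §4.2] -/
def zextL (k q n : ℕ) (S : List OSec) (t₀ : OSec) : Bool :=
  intSolvable D S.length ((eqRows k q n S t₀).map Prod.fst) ((eqRows k q n S t₀).map Prod.snd)

/-- THE OPERATOR `(·)^{ℤ↓}` on lists. [cite: OConghaile2022, §4.3.1] -/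
def reduceL (k q n : ℕ) (S : List OSec) : List OSec := S.filter fun t => forthL k n S t && zextL D k q n S t

/-- Iterating the operator. [cite: OConghaile2022, §4.3.1] -/
def iterL (k q n : ℕ) : ℕ → List OSec → List OSec
  | 0, S => S
  | m + 1, S => iterL k q n m (reduceL D k q n S)

/-- **THE COHOMOLOGICAL `k`-CONSISTENCY ALGORITHM** for graphs: iterate `|𝓗_k| + 1` times from
`𝓗_k(G,H)`, accept iff the result is non-empty. [cite: OConghaile2022, Def. 5] -/
def decideL (k q : ℕ) (adjH : ℕ → ℕ → Bool) (n : ℕ) (adjG : ℕ → ℕ → Bool) : Bool :=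
  !(iterL D k q n ((homSecs k q adjH n adjG).length + 1) (homSecs k q adjH n adjG)).isEmpty

end Program

/-! ### Adjacency tests as Boolean functions on naturals -/

section Adjacency

/-- The adjacency test of the input graph read off its bit string: bit `n i + j`. [cite: AroraBarak2009, §0.1] -/
def adjGfun (n : ℕ) (bits : List Bool) (i j : ℕ) : Bool := bits.getD (n * i + j) false

/-- The adjacency test of the fixed template `H` (a finite table, extended periodically).
[folklore] -/
noncomputable def adjHfun (q : ℕ) (H : SimpleGraph (Fin q)) (c d : ℕ) : Bool := by
  classical
  exact if h : 0 < q then decide (H.Adj ⟨c % q, Nat.mod_lt c h⟩ ⟨d % q, Nat.mod_lt d h⟩) else false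

/-- On colours the table is adjacency in `H`. [folklore] -/
theorem adjHfun_fin (q : ℕ) (H : SimpleGraph (Fin q)) (c d : Fin q) : adjHfun q H c d = true ↔ H.Adj c d := by
  have hq : 0 < q := Fin.pos c
  have hc : (⟨c % q, Nat.mod_lt c hq⟩ : Fin q) = c := Fin.ext (Nat.mod_eq_of_lt c.isLt)
  have hd : (⟨d % q, Nat.mod_lt d hq⟩ : Fin q) = d := Fin.ext (Nat.mod_eq_of_lt d.isLt)
  unfold adjHfun
  rw [dif_pos hq]
  simp only [hc, hd, decide_eq_true_eq]

end Adjacency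

/-! ### The system of a list -/

section Semantics

variable {n q : ℕ}

/-- The section system of a list of (lists of) local sections. [cite: OConghaile2022, §3.1] -/
def sys (S : List OSec) : SectionSystem (Fin n) (Fin q) := fun U => {s | listOfP (pOf U s) ∈ S}

/-- Membership in the system of a list. [folklore] -/
@[simp] theorem mem_sys {S : List OSec} {U : Finset (Fin n)} {s : ↥U → Fin q} : s ∈ sys S U ↔ listOfP (pOf U s) ∈ S := Iff.rfl

/-- The list of a section, abbreviated. [folklore] -/
abbrev L (U : Finset (Fin n)) (s : ↥U → Fin q) : OSec := listOfP (pOf U s)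

/-- `L U` is injective. [folklore] -/
theorem L_injective (U : Finset (Fin n)) : Function.Injective (L (q := q) U) :=
  fun _ _ h => pOf_injective U (listOfP_injective h)

/-- The domain of `L U s`. [folklore] -/
@[simp] theorem domL_L (U : Finset (Fin n)) (s : ↥U → Fin q) : domL (L U s) = vlist U := by
  rw [domL_listOfP, supp_pOf]

/-- A valid list with domain `vlist U` is some `L U s`. [folklore] -/
theorem exists_eq_L_of_domL {t : OSec} (ht : IsValid n q t) {U : Finset (Fin n)} (hd : domL t = vlist U) :
    ∃ s : ↥U → Fin q, t = L U s := by
  obtain ⟨g, rfl⟩ := ht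
  rw [domL_listOfP] at hd
  obtain ⟨s, rfl⟩ := exists_eq_pOf (vlist_injective hd)
  exact ⟨s, rfl⟩

/-- Restricting `L U s` to `vlist D`, `D ⊆ U`. [folklore] -/
theorem restrL_L {D U : Finset (Fin n)} (h : D ⊆ U) (s : ↥U → Fin q) :
    restrL (L U s) (vlist D) = L D (SectionSystem.restrict h s) := by
  rw [restrL_listOfP, restrictP_pOf h]; rfl

/-- A non-empty list of valid lists has a non-empty system, and conversely. [folklore] -/
theorem sys_nonempty_iff {S : List OSec} (hS : ∀ t ∈ S, IsValid n q t) : (sys (n := n) (q := q) S).Nonempty ↔ S ≠ [] := by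
  constructor
  · rintro ⟨U, s, hs⟩ h; rw [h] at hs; simp at hs
  · intro h
    obtain ⟨t, ht⟩ := List.exists_mem_of_ne_nil S h
    obtain ⟨g, rfl⟩ := hS t ht
    refine ⟨supp g, fnOfP g, ?_⟩
    rw [mem_sys, pOf_supp_fnOfP]; exact ht

end Semantics

/-! ### `homSecs` is `𝓗_k(G,H)` -/

section Hom

variable {n q : ℕ}

/-- The indexed entries of the list of `g`. [folklore] -/
theorem enum_listOfP (g : PSec n q) : enum (listOfP g) = List.ofFn fun u : Fin n => ((u : ℕ), (g u).map Fin.val) := by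
  unfold enum
  rw [length_listOfP, listOfP, List.zip_eq_zipWith]
  apply List.ext_getElem (by simp)
  intro i h₁ h₂
  rw [List.getElem_zipWith, List.getElem_range, List.getElem_ofFn, List.getElem_ofFn]

/-- **The hom test on the list of `g`.** [cite: OConghaile2022, §3.1] -/
theorem isHom_listOfP_iff {adjH adjG : ℕ → ℕ → Bool} (g : PSec n q) :
    isHom adjH adjG (listOfP g) = true ↔
      ∀ (u v : Fin n) (c d : Fin q), g u = some c → g v = some d → adjG u v = true → adjH c d = true := by
  simp only [isHom, enum_listOfP, List.all_eq_true, List.mem_ofFn]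
  constructor
  · intro h u v c d hu hv hG
    have := h _ ⟨u, rfl⟩ _ ⟨v, rfl⟩
    simp only [pairOK, hu, hv, Option.map_some, Bool.or_eq_true, Bool.not_eq_true'] at this
    rcases this with h' | h'
    · rw [hG] at h'; exact absurd h' (by simp)
    · exact h'
  · rintro h _ ⟨u, rfl⟩ _ ⟨v, rfl⟩
    simp only [pairOK]
    cases hu : g u with
    | none => rfl
    | some c =>
      cases hv : g v with
      | none => rfl
      | some d =>
        simp only [Option.map_some, Bool.or_eq_true, Bool.not_eq_true']
        by_cases hG : adjG u v = true
        · exact Or.inr (h u v c d hu hv hG)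
        · left; simpa using hG

variable {k : ℕ} {H : SimpleGraph (Fin q)} {G : SimpleGraph (Fin n)} {adjH adjG : ℕ → ℕ → Bool}

/-- **`homSecs` lists exactly `𝓗_k(G,H)`.** [cite: OConghaile2022, §3.1] -/
theorem sys_homSecs (hH : ∀ c d : Fin q, adjH c d = true ↔ H.Adj c d) (hG : ∀ i j : Fin n, adjG i j = true ↔ G.Adj i j) :
    sys (homSecs k q adjH n adjG) = graphHomSystem k G H := by
  funext U; ext s
  rw [mem_sys, homSecs, List.mem_filter, mem_upTo_iff, graphHomSystem, Set.mem_setOf_eq, isHom_listOfP_iff]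
  constructor
  · rintro ⟨⟨g, hg, hcard⟩, hhom⟩
    have : g = pOf U s := (listOfP_injective hg).symm
    subst this
    rw [supp_pOf] at hcard
    refine ⟨hcard, fun u v huv => ?_⟩
    exact (hH _ _).1 (hhom u v (s u) (s v) (pOf_apply_of_mem s u.2) (pOf_apply_of_mem s v.2) ((hG _ _).2 huv))
  · rintro ⟨hcard, hhom⟩
    refine ⟨⟨pOf U s, rfl, by rwa [supp_pOf]⟩, fun u v c d hu hv huv => ?_⟩
    have hu' : u ∈ U := by by_contra h; rw [pOf_apply_of_not_mem s h] at hu; exact Option.some_ne_none c hu.symm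
    have hv' : v ∈ U := by by_contra h; rw [pOf_apply_of_not_mem s h] at hv; exact Option.some_ne_none d hv.symm
    rw [pOf_apply_of_mem s hu', Option.some.injEq] at hu
    rw [pOf_apply_of_mem s hv', Option.some.injEq] at hv
    subst hu; subst hv
    exact (hH _ _).2 (hhom ⟨u, hu'⟩ ⟨v, hv'⟩ ((hG u v).1 huv))

/-- Members of `homSecs` are valid. [folklore] -/
theorem isValid_of_mem_homSecs {t : OSec} (h : t ∈ homSecs k q adjH n adjG) : IsValid n q t :=
  isValid_of_mem_upTo (List.mem_of_mem_filter h)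

/-- `homSecs` is duplicate free. [folklore] -/
theorem nodup_homSecs : (homSecs k q adjH n adjG).Nodup := (nodup_upTo k).filter _

end Hom

/-! ### The forth test -/

section Forth

variable {n q k : ℕ}

/-- `getD` at a vertex after `set`. [folklore] -/
theorem getD_set_listOfP (g : PSec n q) (v u : Fin n) (o : Option ℕ) :
    ((listOfP g).set v o).getD u none = if u = v then o else (g u).map Fin.val := by
  rw [List.getD_eq_getElem?_getD, List.getElem?_set, length_listOfP]
  by_cases h : u = v
  · subst h; simp
  · rw [if_neg (fun e => h (Fin.ext e).symm), if_neg h, ← List.getD_eq_getElem?_getD, getD_listOfP_fin]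

/-- **The forth test on lists is `Forth` on systems** (for a list of valid lists and the list of a
section). [cite: OConghaile2022, §2.2 and §3.3.1] -/
theorem forthL_iff {S : List OSec} (hS : ∀ t ∈ S, IsValid n q t) (C : Finset (Fin n)) (s : ↥C → Fin q) :
    forthL k n S (L C s) = true ↔ SectionSystem.Forth k (sys S) C s := by
  unfold forthL SectionSystem.Forth
  rw [Bool.or_eq_true, Bool.not_eq_true', decide_eq_false_iff_not, domL_L, length_vlist, List.all_eq_true]
  have key : ∀ a : Fin n, (S.any fun t' => forthOK (L C s) t' a) = true ↔
      ∃ t ∈ sys S (insert a C), SectionSystem.restrict (Finset.subset_insert a C) t = s := by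
    intro a
    rw [List.any_eq_true]
    constructor
    · rintro ⟨t', ht', hok⟩
      obtain ⟨g', rfl⟩ := hS t' ht'
      simp only [forthOK, Bool.and_eq_true, beq_iff_eq, Bool.or_eq_true, Bool.not_eq_true', getD_listOfP_fin,
        Option.isSome_map] at hok
      obtain ⟨⟨ha, hset⟩, hsame⟩ := hok
      -- the values of `g'` off `a` are those of `pOf C s`
      have hoff : ∀ u, u ≠ a → g' u = pOf C s u := by
        intro u hu
        have := congrArg (fun t : OSec => t.getD u none) hset
        simp only [getD_set_listOfP, if_neg hu] at this
        exact Option.map_injective Fin.val_injective this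
      have hsupp : supp g' = insert a C := by
        ext u
        by_cases hu : u = a
        · subst hu; simp [ha]
        · rw [mem_supp, hoff u hu, ← mem_supp, supp_pOf, Finset.mem_insert, or_iff_right hu]
      obtain ⟨s', hs'⟩ := exists_eq_pOf hsupp
      refine ⟨s', by rw [mem_sys, ← hs']; exact ht', ?_⟩
      funext ⟨x, hx⟩
      simp only [SectionSystem.restrict]
      by_cases hxa : x = a
      · -- then `a ∈ C`, so `g' = pOf C s`
        subst hxa
        have hsome : (pOf C s x).isSome := by rw [pOf_apply_of_mem s hx]; rfl
        rcases hsame with hns | heq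
        · rw [hns] at hsome; exact (Bool.false_ne_true hsome).elim
        · have := congrFun (listOfP_injective heq) x
          rw [hs', pOf_apply_of_mem s' (Finset.mem_insert_self x C), pOf_apply_of_mem s hx] at this
          exact Option.some.inj this
      · have := hoff x hxa
        rw [hs', pOf_apply_of_mem s' (Finset.mem_insert_of_mem hx), pOf_apply_of_mem s hx] at this
        exact Option.some.inj this
    · rintro ⟨s', hs', hres⟩
      refine ⟨L (insert a C) s', hs', ?_⟩
      simp only [forthOK, Bool.and_eq_true, beq_iff_eq, Bool.or_eq_true, Bool.not_eq_true', getD_listOfP_fin,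
        Option.isSome_map, pOf_apply_of_mem s' (Finset.mem_insert_self a C), Option.isSome_some, true_and]
      constructor
      · refine ext_getD (by simp) fun i hi => ?_
        rw [List.length_set, length_listOfP] at hi
        have e1 := getD_set_listOfP (pOf (insert a C) s') a ⟨i, hi⟩ none
        have e2 := getD_set_listOfP (pOf C s) a ⟨i, hi⟩ none
        rw [e1, e2]
        by_cases hia : (⟨i, hi⟩ : Fin n) = a
        · rw [if_pos hia, if_pos hia]
        · rw [if_neg hia, if_neg hia]
          by_cases hiC : (⟨i, hi⟩ : Fin n) ∈ C
          · rw [pOf_apply_of_mem s hiC, pOf_apply_of_mem s' (Finset.mem_insert_of_mem hiC), ← hres]; rfl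
          · rw [pOf_apply_of_not_mem s hiC, pOf_apply_of_not_mem s']
            rw [Finset.mem_insert]; rintro (h | h); exacts [hia h, hiC h]
      · by_cases haC : a ∈ C
        · right
          unfold L; congr 1
          funext u
          by_cases hu : u ∈ C
          · rw [pOf_apply_of_mem s hu, pOf_apply_of_mem s' (Finset.mem_insert_of_mem hu), ← hres]; rfl
          · have hua : u ≠ a := fun h => hu (h ▸ haC)
            rw [pOf_apply_of_not_mem s hu, pOf_apply_of_not_mem s']
            rw [Finset.mem_insert]; rintro (h | h); exacts [hua h, hu h]
        · left; rw [pOf_apply_of_not_mem s haC]; rfl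
  constructor
  · rintro (hk | hall)
    · intro hlt; exact absurd hlt hk
    · intro _ a; exact (key a).1 (hall a (List.mem_range.2 a.isLt))
  · intro h
    by_cases hk : C.card < k
    · right; intro a ha
      rw [List.mem_range] at ha
      exact (key ⟨a, ha⟩).2 (h hk ⟨a, ha⟩)
    · left; exact hk

end Forth

/-! ### The linear system of `ℤext` -/

section ZExt

variable {n q k : ℕ} {D : List (List ℤ) → ℤ} {S : List OSec}

/-- `mapDomain` evaluated, over a finite domain. [folklore] -/
theorem mapDomain_apply_eq_sum {α β : Type} [Fintype α] [DecidableEq β] (f : α → β) (v : α →₀ ℤ) (b : β) :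
    Finsupp.mapDomain f v b = ∑ a, if f a = b then v a else 0 := by
  classical
  rw [Finsupp.mapDomain, Finsupp.sum_apply, Finsupp.sum_fintype _ _ (fun a => by simp)]
  exact Finset.sum_congr rfl fun a _ => by rw [Finsupp.single_apply]

/-- A coefficient–unknown sum over the positions of `S` is a sum over the members weighted by the
"total unknown of a member" `X t = Σ_{j : S_j = t} x_j`. [folklore] -/
theorem sum_fin_eq_sum_toFinset (φ : OSec → ℤ) (x : Fin S.length → ℤ) :
    ∑ j : Fin S.length, φ (S.get j) * x j =
      ∑ t ∈ S.toFinset, φ t * ∑ j : Fin S.length, (if S.get j = t then x j else 0) := by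
  classical
  have h1 : ∀ j : Fin S.length, φ (S.get j) * x j = ∑ t ∈ S.toFinset, (if S.get j = t then φ t * x j else 0) := by
    intro j
    rw [Finset.sum_ite_eq S.toFinset (S.get j) (fun t => φ t * x j), if_pos (List.mem_toFinset.2 (List.get_mem S j))]
  simp_rw [h1]
  rw [Finset.sum_comm]
  refine Finset.sum_congr rfl fun t _ => ?_
  rw [Finset.mul_sum]
  refine Finset.sum_congr rfl fun j _ => ?_
  split_ifs with h
  · rfl
  · rw [mul_zero]

/-- For a duplicate-free `S`, evaluating a function at the positions. [folklore] -/
theorem sum_fin_eq_sum_toFinset_of_nodup (hnd : S.Nodup) (φ Y : OSec → ℤ) :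
    ∑ j : Fin S.length, φ (S.get j) * Y (S.get j) = ∑ t ∈ S.toFinset, φ t * Y t := by
  classical
  rw [List.sum_toFinset _ hnd, ← List.sum_ofFn]
  congr 1
  apply List.ext_getElem (by simp)
  intro i h₁ h₂
  simp

/-- The ABSTRACT SYSTEM on a function of the members: the pin equations and the compatibility
equations. [cite: OConghaile2022, §4.2] -/
def Eqs (k q n : ℕ) (S : List OSec) (t₀ : OSec) (Y : OSec → ℤ) : Prop :=
  (∀ t ∈ S, domL t = domL t₀ → (∑ t' ∈ S.toFinset, ind (t' == t) * Y t') = ind (t == t₀)) ∧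
    ∀ Ul ∈ domsUpTo n k, ∀ Dl ∈ subl k Ul, ∀ ul ∈ colourings q n k Dl,
      (∑ t ∈ S.toFinset, (ind (domL t == Ul && restrL t Dl == ul) - ind (t == ul)) * Y t) = 0

/-- Rows of the program have length `|S|`. [folklore] -/
theorem length_of_mem_eqRows {t₀ : OSec} {e : List ℤ × ℤ} (he : e ∈ eqRows k q n S t₀) : e.1.length = S.length := by
  simp only [eqRows, List.mem_append, pinRows, compatRows, List.mem_map, List.mem_filter, List.mem_flatMap, compatRow] at he
  rcases he with ⟨t, -, rfl⟩ | ⟨Ul, -, Dl, -, ul, -, rfl⟩ <;> simp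

/-- `getD` of a mapped list at a position. [folklore] -/
theorem getD_map_get (φ : OSec → ℤ) (j : Fin S.length) : (S.map φ).getD j 0 = φ (S.get j) := by
  rw [List.getD_eq_getElem _ _ (by simp), List.getElem_map]; rfl

/-- **The program's system is solvable over `ℤ` iff the abstract system has a solution vanishing off
`S`.** [cite: OConghaile2022, §4.2] -/
theorem zextL_iff_exists_eqs (hD : DetCorrect D) (hnd : S.Nodup) (t₀ : OSec) :
    zextL D k q n S t₀ = true ↔ ∃ Y : OSec → ℤ, (∀ t ∉ S, Y t = 0) ∧ Eqs k q n S t₀ Y := by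
  classical
  set E := eqRows k q n S t₀ with hE
  obtain ⟨M, hM⟩ := exists_rows (E.map Prod.fst) (k := E.length) (by simp) (fun v hv => by
    obtain ⟨e, he, rfl⟩ := List.mem_map.1 hv; exact length_of_mem_eqRows he)
  have hb : E.map Prod.snd = List.ofFn fun i : Fin E.length => (E.get i).2 := by
    apply List.ext_getElem (by simp)
    intro i h₁ h₂
    simp
  -- entries of `M`
  have hMij : ∀ (i : Fin E.length) (j : Fin S.length), M i j = (E.get i).1.getD j 0 := by
    intro i j
    have h1 := rows_getD M i.isLt
    rw [hM, List.getD_eq_getElem _ _ (by simp), List.getElem_map] at h1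
    rw [List.get_eq_getElem, h1, getD_ofFn, dif_pos j.isLt]
  -- row by row
  have hrow : ∀ x : Fin S.length → ℤ, (M.mulVec x = fun i => (E.get i).2) ↔
      ∀ e ∈ E, (∑ j : Fin S.length, e.1.getD j 0 * x j) = e.2 := by
    intro x
    constructor
    · intro h e he
      obtain ⟨i, rfl⟩ := List.mem_iff_get.1 he
      have := congrFun h i
      rw [Matrix.mulVec, dotProduct] at this
      simpa only [hMij] using this
    · intro h; funext i
      rw [Matrix.mulVec, dotProduct]
      simpa only [hMij] using h _ (List.get_mem E i)
  -- every row is `S.map φ` for a coefficient function `φ`, and the rows are the abstract equations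
  have key : ∀ Y : OSec → ℤ, Eqs k q n S t₀ Y ↔
      ∀ e ∈ E, ∃ φ : OSec → ℤ, e.1 = S.map φ ∧ (∑ t ∈ S.toFinset, φ t * Y t) = e.2 := by
    intro Y
    have hcongr : ∀ ψ φ : OSec → ℤ, S.map ψ = S.map φ →
        (∑ t ∈ S.toFinset, ψ t * Y t) = ∑ t ∈ S.toFinset, φ t * Y t := fun ψ φ h =>
      Finset.sum_congr rfl fun t ht => by rw [(List.map_inj_left.1 h) t (List.mem_toFinset.1 ht)]
    constructor
    · rintro ⟨hpin, hcompat⟩ e he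
      rw [hE, eqRows, List.mem_append] at he
      rcases he with he | he
      · simp only [pinRows, List.mem_map, List.mem_filter, beq_iff_eq] at he
        obtain ⟨t, ⟨ht, hdom⟩, rfl⟩ := he
        exact ⟨_, rfl, hpin t ht hdom⟩
      · simp only [compatRows, List.mem_flatMap, List.mem_map] at he
        obtain ⟨Ul, hUl, Dl, hDl, ul, hul, rfl⟩ := he
        exact ⟨_, rfl, hcompat Ul hUl Dl hDl ul hul⟩
    · intro h
      constructor
      · intro t ht hdom
        obtain ⟨φ, hφ, hsum⟩ := h (S.map fun t' => ind (t' == t), ind (t == t₀))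
          (by rw [hE, eqRows]; exact List.mem_append_left _ (List.mem_map.2 ⟨t, List.mem_filter.2 ⟨ht, by simpa using hdom⟩, rfl⟩))
        exact (hcongr _ _ hφ).trans hsum
      · intro Ul hUl Dl hDl ul hul
        obtain ⟨φ, hφ, hsum⟩ := h (compatRow S Ul Dl ul)
          (by rw [hE, eqRows]; exact List.mem_append_right _ (List.mem_flatMap.2 ⟨Ul, hUl, List.mem_flatMap.2 ⟨Dl, hDl, List.mem_map.2 ⟨ul, hul, rfl⟩⟩⟩))
        exact (hcongr _ _ hφ).trans hsum
  -- every row of `E` has the shape `S.map φ`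
  have hshape : ∀ e ∈ E, ∃ φ : OSec → ℤ, e.1 = S.map φ := by
    intro e he
    rw [hE, eqRows, List.mem_append] at he
    rcases he with he | he
    · simp only [pinRows, List.mem_map, List.mem_filter] at he
      obtain ⟨t, -, rfl⟩ := he; exact ⟨_, rfl⟩
    · simp only [compatRows, List.mem_flatMap, List.mem_map] at he
      obtain ⟨Ul, -, Dl, -, ul, -, rfl⟩ := he; exact ⟨_, rfl⟩
  -- assemble
  change intSolvable D S.length (E.map Prod.fst) (E.map Prod.snd) = true ↔ _
  rw [← hM, hb, intSolvable_iff hD]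
  constructor
  · rintro ⟨x, hx⟩
    refine ⟨fun t => ∑ j : Fin S.length, (if S.get j = t then x j else 0), fun t ht => ?_, (key _).2 fun e he => ?_⟩
    · exact Finset.sum_eq_zero fun j _ => if_neg fun h : S.get j = t => ht (h ▸ List.get_mem S j)
    · obtain ⟨φ, hφ⟩ := hshape e he
      refine ⟨φ, hφ, ?_⟩
      have := (hrow x).1 hx e he
      rw [hφ] at this
      rw [← sum_fin_eq_sum_toFinset, ← this]
      exact Finset.sum_congr rfl fun j _ => by rw [getD_map_get]
  · rintro ⟨Y, -, hY⟩
    refine ⟨fun j => Y (S.get j), (hrow _).2 fun e he => ?_⟩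
    obtain ⟨φ, hφ, hsum⟩ := (key Y).1 hY e he
    rw [hφ, ← hsum, ← sum_fin_eq_sum_toFinset_of_nodup hnd]
    exact Finset.sum_congr rfl fun j _ => by rw [getD_map_get]

variable (hS : ∀ t ∈ S, IsValid n q t)
include hS

/-- **The image identity**: summing over the sections of `U` restricting to `u` is summing over the
members of `S` over `U` whose restriction is the list of `u` (for `Y` vanishing off `S`).
[folklore] -/
theorem sum_restrict_eq {D' U : Finset (Fin n)} (h : D' ⊆ U) (u : ↥D' → Fin q) (Y : OSec → ℤ) (hY : ∀ t ∉ S, Y t = 0) :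
    (∑ s' : ↥U → Fin q, if SectionSystem.restrict h s' = u then Y (L U s') else 0) =
      ∑ t ∈ S.toFinset, ind (domL t == vlist U && restrL t (vlist D') == L D' u) * Y t := by
  classical
  -- both sides are sums of `Y` over the same finset
  have hR : (∑ t ∈ S.toFinset, ind (domL t == vlist U && restrL t (vlist D') == L D' u) * Y t) =
      ∑ t ∈ S.toFinset.filter (fun t => domL t = vlist U ∧ restrL t (vlist D') = L D' u), Y t := by
    rw [Finset.sum_filter]
    refine Finset.sum_congr rfl fun t _ => ?_
    by_cases ht : domL t = vlist U ∧ restrL t (vlist D') = L D' u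
    · rw [if_pos ht]; simp [ind, ht]
    · rw [if_neg ht]
      have : (domL t == vlist U && restrL t (vlist D') == L D' u) = false := by simpa [not_and_or] using ht
      simp [ind, this]
  have hL : (∑ s' : ↥U → Fin q, if SectionSystem.restrict h s' = u then Y (L U s') else 0) =
      ∑ s' ∈ Finset.univ.filter (fun s' : ↥U → Fin q => SectionSystem.restrict h s' = u ∧ L U s' ∈ S), Y (L U s') := by
    rw [Finset.sum_filter]
    refine Finset.sum_congr rfl fun s' _ => ?_
    by_cases h1 : SectionSystem.restrict h s' = u
    · by_cases h2 : L U s' ∈ S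
      · rw [if_pos h1, if_pos ⟨h1, h2⟩]
      · rw [if_pos h1, if_neg (fun h' => h2 h'.2), hY _ h2]
    · rw [if_neg h1, if_neg (fun h' => h1 h'.1)]
  rw [hR, hL, ← Finset.sum_image (f := Y) (fun s' _ s'' _ h' => L_injective U h')]
  apply Finset.sum_congr _ fun _ _ => rfl
  ext t
  simp only [Finset.mem_image, Finset.mem_filter, Finset.mem_univ, true_and, List.mem_toFinset]
  constructor
  · rintro ⟨s', ⟨hres, hmem⟩, rfl⟩
    exact ⟨hmem, domL_L U s', by rw [restrL_L h, hres]⟩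
  · rintro ⟨hmem, hdom, hres⟩
    obtain ⟨s', rfl⟩ := exists_eq_L_of_domL (hS t hmem) hdom
    rw [restrL_L h] at hres
    exact ⟨s', ⟨L_injective D' hres, hmem⟩, rfl⟩

omit hS in
/-- The sum of a pinned indicator. [folklore] -/
theorem sum_ind_eq (ul : OSec) (Y : OSec → ℤ) (hY : ∀ t ∉ S, Y t = 0) :
    (∑ t ∈ S.toFinset, ind (t == ul) * Y t) = Y ul := by
  classical
  have : ∀ t, ind (t == ul) * Y t = if t = ul then Y t else 0 := fun t => by
    by_cases h : t = ul <;> simp [ind, h]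
  simp_rw [this]
  rw [Finset.sum_ite_eq']
  split_ifs with h
  · rfl
  · exact (hY ul (fun h' => h (List.mem_toFinset.2 h'))).symm

/-- **The abstract system has a solution vanishing off `S` iff `ℤext(𝓢, s)`** (`t₀ = L C s ∈ S`).
[cite: OConghaile2022, §4.2] -/
theorem exists_eqs_iff_zext {C : Finset (Fin n)} {s : ↥C → Fin q} (ht₀ : L C s ∈ S) :
    (∃ Y : OSec → ℤ, (∀ t ∉ S, Y t = 0) ∧ Eqs k q n S (L C s) Y) ↔ SectionSystem.ZExt k (sys S) C s := by
  classical
  constructor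
  · rintro ⟨Y, hY0, hpin, hcompat⟩
    let r : ZSections (Fin n) (Fin q) := fun U => Finsupp.equivFunOnFinite.symm fun s' => Y (L U s')
    have hr : ∀ (U : Finset (Fin n)) (s' : ↥U → Fin q), r U s' = Y (L U s') := fun U s' => rfl
    refine ⟨r, ⟨fun U s' hne => ?_, fun D' U h hU => ?_⟩, ?_⟩
    · -- support
      rw [hr] at hne
      rw [mem_sys]
      by_contra hmem
      exact hne (hY0 _ hmem)
    · -- compatibility, from the compatibility equation of `(vlist U, vlist D', L D' u)`
      ext u
      have hD'k : D'.card ≤ k := (Finset.card_le_card h).trans hU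
      have hUl : vlist U ∈ domsUpTo n k := (mem_domsUpTo_iff k _).2 ⟨U, hU, rfl⟩
      have hDl : vlist D' ∈ subl k (vlist U) := mem_subl_of_sublist k _ _ (vlist_sublist_of_subset h) (by rw [length_vlist]; exact hU)
      have hul : L D' u ∈ colourings q n k (vlist D') := (mem_colourings_iff k D' hD'k _).2 ⟨pOf D' u, rfl, supp_pOf D' u⟩
      have heq := hcompat _ hUl _ hDl _ hul
      rw [Finset.sum_congr rfl (fun t _ => sub_mul _ _ (Y t)), Finset.sum_sub_distrib, sub_eq_zero,
        ← sum_restrict_eq hS h u Y hY0, sum_ind_eq _ Y hY0] at heq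
      rw [mapDomain_apply_eq_sum, hr]
      simp only [hr]
      exact heq
    · -- `r C = 1 • s`
      ext s'
      rw [hr, Finsupp.single_apply]
      by_cases hmem : L C s' ∈ S
      · have := hpin _ hmem (by rw [domL_L, domL_L])
        rw [sum_ind_eq _ Y hY0] at this
        rw [this]
        by_cases hss : s = s'
        · subst hss; simp [ind]
        · rw [if_neg hss]
          have : (L C s' == L C s) = false := by
            rw [beq_eq_false_iff_ne]; exact fun h => hss (L_injective C h).symm
          simp [ind, this]
      · rw [hY0 _ hmem, if_neg]
        rintro rfl; exact hmem ht₀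
  · rintro ⟨r, ⟨hsupp, hcompat⟩, hrC⟩
    -- the candidate solution: `Y t = r U s'` for `t = L U s' ∈ S`
    let ρ : PSec n q → ℤ := fun g => r (supp g) (fnOfP g)
    let Y : OSec → ℤ := fun t => if t ∈ S then ρ (gOf n q t) else 0
    have hrcongr : ∀ (U U' : Finset (Fin n)) (s' : ↥U → Fin q) (s'' : ↥U' → Fin q), U' = U → pOf U' s'' = pOf U s' → r U' s'' = r U s' := by
      intro U U' s' s'' hUU h; subst hUU; rw [pOf_injective _ h]
    have hρ : ∀ (U : Finset (Fin n)) (s' : ↥U → Fin q), ρ (pOf U s') = r U s' := fun U s' =>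
      hrcongr U _ s' _ (supp_pOf U s') (pOf_supp_fnOfP _)
    have hYL : ∀ (U : Finset (Fin n)) (s' : ↥U → Fin q), Y (L U s') = r U s' := by
      intro U s'
      simp only [Y]
      split_ifs with hmem
      · rw [gOf_listOfP, hρ]
      · by_contra hne
        exact hmem ((mem_sys.1 (hsupp U s' (Ne.symm hne))))
    have hY0 : ∀ t ∉ S, Y t = 0 := fun t ht => if_neg ht
    refine ⟨Y, hY0, fun t ht hdom => ?_, fun Ul hUl Dl hDl ul hul => ?_⟩
    · -- pin equations
      rw [domL_L] at hdom
      obtain ⟨s', rfl⟩ := exists_eq_L_of_domL (hS t ht) hdom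
      rw [sum_ind_eq _ Y hY0, hYL, hrC, Finsupp.single_apply]
      by_cases hss : s = s'
      · subst hss; simp [ind]
      · rw [if_neg hss]
        have : (L C s' == L C s) = false := by
          rw [beq_eq_false_iff_ne]; exact fun h => hss (L_injective C h).symm
        simp [ind, this]
    · -- compatibility equations
      obtain ⟨U, hU, rfl⟩ := (mem_domsUpTo_iff k Ul).1 hUl
      obtain ⟨D', hD'U, rfl⟩ := exists_eq_vlist_of_sublist (sublist_of_mem_subl k _ _ hDl)
      have hD'k : D'.card ≤ k := (Finset.card_le_card hD'U).trans hU
      obtain ⟨g, rfl, hg⟩ := (mem_colourings_iff k D' hD'k ul).1 hul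
      obtain ⟨u, rfl⟩ := exists_eq_pOf hg
      rw [Finset.sum_congr rfl (fun t _ => sub_mul _ _ (Y t)), Finset.sum_sub_distrib, sub_eq_zero]
      change (∑ t ∈ S.toFinset, ind (domL t == vlist U && restrL t (vlist D') == L D' u) * Y t) =
        ∑ t ∈ S.toFinset, ind (t == L D' u) * Y t
      rw [← sum_restrict_eq hS hD'U u Y hY0, sum_ind_eq _ Y hY0, hYL]
      have := congrArg (fun f : (↥D' → Fin q) →₀ ℤ => f u) (hcompat hD'U hU)
      rw [mapDomain_apply_eq_sum] at this
      rw [← this]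
      exact Finset.sum_congr rfl fun s' _ => by rw [hYL]

omit hS in
/-- **The `ℤext` test on lists is `ℤext` on systems** (for a duplicate-free list of valid lists and
a member `L C s`). [cite: OConghaile2022, §4.2] -/
theorem zextL_iff (hD : DetCorrect D) (hS : ∀ t ∈ S, IsValid n q t) (hnd : S.Nodup) {C : Finset (Fin n)} {s : ↥C → Fin q}
    (ht₀ : L C s ∈ S) : zextL D k q n S (L C s) = true ↔ SectionSystem.ZExt k (sys S) C s := by
  rw [zextL_iff_exists_eqs hD hnd, exists_eqs_iff_zext hS ht₀]

end ZExt

/-! ### The operator, the iteration, the verdict -/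

section Main

variable {n q k : ℕ} {D : List (List ℤ) → ℤ}

/-- **`reduceL` is `(·)^{ℤ↓}` on systems.** [cite: OConghaile2022, §4.3.1] -/
theorem sys_reduceL (hD : DetCorrect D) {S : List OSec} (hS : ∀ t ∈ S, IsValid n q t) (hnd : S.Nodup) :
    sys (reduceL D k q n S) = SectionSystem.reduce k (sys (n := n) (q := q) S) := by
  funext U; ext s
  rw [mem_sys, reduceL, List.mem_filter, Bool.and_eq_true, SectionSystem.reduce, Set.mem_setOf_eq, mem_sys]
  constructor
  · rintro ⟨hmem, hf, hz⟩
    exact ⟨hmem, (forthL_iff hS U s).1 hf, (zextL_iff hD hS hnd hmem).1 hz⟩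
  · rintro ⟨hmem, hf, hz⟩
    exact ⟨hmem, (forthL_iff hS U s).2 hf, (zextL_iff hD hS hnd hmem).2 hz⟩

/-- `iterL` is the iterate of `reduceL`. [folklore] -/
theorem iterL_eq_iterate (m : ℕ) (S : List OSec) : iterL D k q n m S = (reduceL D k q n)^[m] S := by
  induction m generalizing S with
  | zero => rfl
  | succ m ih => rw [iterL, ih, Function.iterate_succ_apply]

/-- `reduceL` yields a sublist. [folklore] -/
theorem reduceL_sublist (S : List OSec) : (reduceL D k q n S).Sublist S := List.filter_sublist

/-- Iterates are sublists. [folklore] -/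
theorem iterate_reduceL_sublist (m : ℕ) (S : List OSec) : ((reduceL D k q n)^[m] S).Sublist S := by
  induction m generalizing S with
  | zero => exact List.Sublist.refl S
  | succ m ih => rw [Function.iterate_succ_apply]; exact (ih _).trans (reduceL_sublist S)

/-- **The iterates compute the iterates of `(·)^{ℤ↓}`.** [cite: OConghaile2022, §4.3.1] -/
theorem sys_iterate_reduceL (hD : DetCorrect D) (m : ℕ) {S : List OSec} (hS : ∀ t ∈ S, IsValid n q t) (hnd : S.Nodup) :
    sys ((reduceL D k q n)^[m] S) = (SectionSystem.reduce k)^[m] (sys (n := n) (q := q) S) := by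
  induction m generalizing S with
  | zero => rfl
  | succ m ih =>
    rw [Function.iterate_succ_apply, Function.iterate_succ_apply, ← sys_reduceL hD hS hnd]
    exact ih (fun t ht => hS t ((reduceL_sublist S).subset ht)) (hnd.sublist (reduceL_sublist S))

/-- **The iteration stabilises within `|S|` steps.** [cite: OConghaile2022, Appendix (proof of Prop. "efficient")] -/
theorem exists_iterate_succ_eq (S : List OSec) :
    ∃ m, m ≤ S.length ∧ (reduceL D k q n)^[m + 1] S = (reduceL D k q n)^[m] S := by
  by_contra hne
  push Not at hne
  have hlt : ∀ m, m ≤ S.length + 1 → ((reduceL D k q n)^[m] S).length + m ≤ S.length := by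
    intro m
    induction m with
    | zero => intro _; simp
    | succ m ih =>
      intro hm
      have h1 := ih (by omega)
      have hsub : ((reduceL D k q n)^[m + 1] S).Sublist ((reduceL D k q n)^[m] S) := by
        rw [Function.iterate_succ_apply']; exact reduceL_sublist _
      have h2 : ((reduceL D k q n)^[m + 1] S).length < ((reduceL D k q n)^[m] S).length := by
        refine lt_of_le_of_ne hsub.length_le fun heq => hne m (by omega) (hsub.eq_of_length heq)
      omega
  have := hlt (S.length + 1) le_rfl
  omega

/-- Once stable, the iteration stays. [folklore] -/
theorem iterate_eq_of_stable {S : List OSec} {m : ℕ} (h : (reduceL D k q n)^[m + 1] S = (reduceL D k q n)^[m] S) (j : ℕ) :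
    (reduceL D k q n)^[m + j] S = (reduceL D k q n)^[m] S := by
  induction j with
  | zero => rfl
  | succ j ih => rw [← Nat.add_assoc, Function.iterate_succ_apply', ih, ← Function.iterate_succ_apply' (f := reduceL D k q n), h]

variable {H : SimpleGraph (Fin q)} {G : SimpleGraph (Fin n)} {adjH adjG : ℕ → ℕ → Bool}

/-- **CORRECTNESS OF THE ALGORITHM**: with a determinant routine `D` and the adjacency tests of `G`
and `H`, `decideL` accepts iff `G →^ℤ_k H`. [cite: OConghaile2022, Def. 5 and Appendix (proof of Prop. "efficient")] -/
theorem decideL_eq_true_iff (hD : DetCorrect D) (hH : ∀ c d : Fin q, adjH c d = true ↔ H.Adj c d)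
    (hG : ∀ i j : Fin n, adjG i j = true ↔ G.Adj i j) :
    decideL D k q adjH n adjG = true ↔ GraphCohomologicallyKConsistent k G H := by
  set S₀ := homSecs k q adjH n adjG with hS₀
  have hval : ∀ t ∈ S₀, IsValid n q t := fun t ht => isValid_of_mem_homSecs ht
  have hnd : S₀.Nodup := nodup_homSecs
  obtain ⟨m, hm, hstab⟩ := exists_iterate_succ_eq (D := D) (k := k) (q := q) (n := n) S₀
  -- the final list is the stable iterate
  have hfin : (reduceL D k q n)^[S₀.length + 1] S₀ = (reduceL D k q n)^[m] S₀ := by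
    have := iterate_eq_of_stable hstab (S₀.length + 1 - m)
    rwa [Nat.add_sub_cancel' (by omega)] at this
  -- the gfp is the system of the stable iterate
  have hgfp : SectionSystem.gfp k (graphHomSystem k G H) = sys ((reduceL D k q n)^[m] S₀) := by
    rw [← sys_homSecs hH hG, ← hS₀, sys_iterate_reduceL hD m hval hnd]
    apply SectionSystem.gfp_eq_iterate_of_eq
    rw [← sys_iterate_reduceL hD (m + 1) hval hnd, ← sys_iterate_reduceL hD m hval hnd, hstab]
  rw [GraphCohomologicallyKConsistent, hgfp, sys_nonempty_iff (fun t ht => hval t ((iterate_reduceL_sublist m S₀).subset ht)),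
    decideL, ← hS₀, iterL_eq_iterate, hfin]
  cases (reduceL D k q n)^[m] S₀ <;> simp

end Main

end GCKCDecide

end Literature.ModelTheory.FiniteModelTheory
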